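import Summits.NavierStokesRegularity.NavierStokesRegularity.Theses.ExtremalEnstrophy
import Literature.Analysis.FluidPDE.AxisymmetricEuler
import HarnessLib.Audit

/-!
# Birth skeleton (BC3) of the crux `ExtremalEnstrophy.MaximiserRigidity` — line `birth`

(crux item `stmt-NavierStokesRegularity-18663`, rank 2, the deciding crux V2 of route
`route-NavierStokesRegularity-ExtremalEnstrophy`; tree path
`Cruxes/MaximiserRigidity/Lines/birth.lean`; registrar
`planner-skel-stmt-NavierStokesRegularity-18663-0`, 2026-08-17. The opening planner's pre-birth
copy `bc/MaximiserRigidity_birth.lean` is attached to the item as evidence but is not readable from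
a registrar seat; this skeleton re-types the route header's TWO-LAYER PLAN
`MaximiserRigidity ⇐ MaximiserSymmetry (V2a) → SwirlFreeMaximiserLaw (V2b)`.)

THE CRUX (V2). For every `ν > 0` there is `C = C(ν) ≥ 1` such that at every level `(E, Z, T)`
(`E, Z, T > 0`, `𝒵_ν(E, Z, T) = maxEnstrophy ν E Z T < ∞`) every EXACT maximiser — an admissible
Leray–Hopf trajectory `u` with `∫|u 0|² ≤ E`, `‖∇(u 0)‖² ≤ Z` whose enstrophy at an observation time
`0 ≤ t ≤ T`, `t < T'` equals `𝒵_ν(E, Z, T)` — has `‖∇u(t)‖² ≤ Φ_C(E, Z)/2 = C·Z·(1 + √(E Z))/2`.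
Since the conclusion is a bound on the VALUE `𝒵_ν(E, Z, T)` at attained levels, the structure of
maximisers is a tool, not the target — which is what makes the existential form of V2a below enough.

THE LINE (the route header's mechanism, typed): SYMMETRIC MAXIMISER → SWIRL-FREE LAW.

* `stub_symmetricMaximiserExists` (V2a, symmetry inheritance, EXISTENTIAL form; size L; open).
  Whenever the maximal enstrophy of a finite level is attained at all, it is attained by an
  admissible trajectory which is axisymmetric WITHOUT SWIRL about the standard axis at every time of
  `[0, t]` (`IsAxisymmetric (u s) ∧ HasNoSwirl (u s)`, pointwise — the statement is existential, so a
  good representative may be chosen: the trajectory is strong, hence smooth, on `(0, t]` at a finite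
  level, and the `H¹` datum is replaced by a symmetric representative on a null set). This is WEAKER
  than the card's V2a "every exact maximiser is axisymmetric swirl-free up to rigid motion": it
  follows from it by the Euclidean invariance of the Leray–Hopf class, of `eEnergy`, `eWeakGradL2Sq`
  and hence of `maxEnstrophy` (a rigid motion carries a maximiser to a maximiser), and it is also
  reachable by symmetrisation / rearrangement of a maximising element without classifying all
  maximisers. It is typed existentially ON PURPOSE: the universal pointwise form is refutable by
  junk (modify a maximiser on a spatial null set at one time — every hypothesis is integral-defined)
  and, at small scale-invariant size `E Z ≤ κ(ν)` where enstrophy decays and `𝒵 = Z` is attained at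
  `t = 0` by EVERY datum of enstrophy `Z`, by honest non-symmetric data; the existential form is
  consistent there (a scaled swirl-free vortex-ring datum of energy `≤ E`, enstrophy `Z`).
  Evidence for / against: Lu–Doering 2008 (the maximising branch of `d𝓔/dt` at large enstrophy is an
  axisymmetric pair of colliding vortex rings), Kang–Yun–Protas 2020 §5 (finite-time optimal data are
  ring-like, growth `≈ 𝓔₀^{3/2}`), Ramirez–Protas 2026 (arXiv:2604.13338: symmetry loss for extended
  maximisers — the named risk of the item).
* `stub_swirlFreeMaximiserLaw` (V2b, the swirl-free law AT MAXIMISERS; size XL; open — load-bearing).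
  For every `ν > 0` there is `C ≥ 1` such that an exact maximiser of a finite level which is
  axisymmetric without swirl on `[0, t]` has `‖∇u(t)‖² ≤ Φ_C(E, Z)/2`. The available structure:
  for swirl-free axisymmetric flows `ω = ω_θ e_θ` and `ω_θ / r` is transported–diffused
  (Ukhovskii–Yudovich 1968, Ladyzhenskaya 1968; Lemarié-Rieusset 2016 Thm. 10.4, tree facts
  `axisymmetricNoSwirl_enstrophy_apriori` (PROVED, `…AprioriProofs`) and
  `axisymmetricNoSwirl_weightedEnstrophy_le`), which gives GLOBAL REGULARITY but, as printed, an
  enstrophy bound depending on `‖ω₀ / r‖₂` resp. `‖∇ω₀‖₂` — not on `(E, Z)` alone (`ω_θ / r ∉ L²`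
  for general `H¹` data: the item's why-it-might-fail). The stub asks for the `(E, Z)`-uniform law
  only AT EXACT MAXIMISERS, where the Euler–Lagrange / KKT system of the finite-time problem
  (Ayala–Protas 2017 §3) is available in addition; the constant `C(ν)` absorbs the dimensional
  factor (`E Z / ν⁴` is the scale-invariant size). At small size the bound reads `Z ≤ C Z (1+√(EZ))/2`,
  so `C ≥ 2` is forced — harmless.
* `MaximiserRigidity_of_hyps` (the composition over the two stub STATEMENTS, real proof, closed —
  axioms propext / Classical.choice / Quot.sound): take `C` from V2b; an exact maximiser `u` at level
  `(E, Z, T)` witnesses `IsMaxEnstrophyAttained ν E Z T`, so V2a gives a symmetric maximiser `v`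
  with `‖∇v(s)‖² = 𝒵 = ‖∇u(t)‖²`, and V2b bounds it. `MaximiserRigidity_of : MaximiserRigidity`
  applies it to the two registered stubs BY NAME (A12 shape: the only theorem of this file concluding
  the crux by name; closed modulo the two stub `sorry`s).

DISPROOF / NEGATIVES USED. No `Disproof.lean` exists for this crux (2026-08-17, `ledger crux ls`:
no workfiles). `ledger negatives --problem NavierStokesRegularity` (5 entries: OddMorawetzLocal,
FiniteTangentModuli, PerpetualPump Thesis, CorrectorSolvable, BlowupClayNonuniqueness) — none concerns
enstrophy maximisation, Leray–Hopf trajectories at finite enstrophy budget, or axisymmetric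
swirl-free flows; neither stub restates or instantiates a refuted statement.

BARRIERS (route header, per stub). `TaoAveragedBlowup`: V2b is false for averaged bilinear forms
(Tao's cascade is an unbounded maximising family) and is routed, as it must be, through
non-averaged algebra — the `ω_θ / r` transport identity of genuinely axisymmetric swirl-free
Navier–Stokes; V2a is a statement about the TRUE equation's maximisers (Euclidean symmetry of the
nonlinearity), meaningless for a generic averaged equation. `EnergySupercriticality`: the only
coercive use of energy/enstrophy is at exact maximisers of the SUBCRITICAL value function; the bet
is V2a. `NavierStokesInequalitySingularSolution`: maximisers solve the equality (KKT), not Scheffer's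
inequality.
-/

noncomputable section

open Set MeasureTheory Filter Topology
open scoped ENNReal NNReal
open Literature.Analysis.FluidPDE

namespace Summit.NavierStokesRegularity.NavierStokesRegularity.Cruxes.MaximiserRigidity.Birth

open Summit.NavierStokesRegularity.NavierStokesRegularity.Theses.ExtremalEnstrophy

set_option linter.unusedVariables false
set_option linter.dupNamespace false

local notation "ℝ³" => EuclideanSpace ℝ (Fin 3)

/-- **stub 1 — `stub_symmetricMaximiserExists` (V2a, symmetry inheritance in existential form;
size L).** At every finite level `(E, Z, T)` of the extreme-enstrophy problem at viscosity `ν > 0`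
whose maximal enstrophy is attained, it is attained by an admissible Leray–Hopf trajectory within
budget which is axisymmetric without swirl (about the `x₂`-axis) at every time of `[0, t]`, `t` the
observation time: `∃ (T', u, t)`, `IsLerayHopfTrajectory ν T' u`, `∫|u 0|² ≤ E`, `‖∇(u 0)‖² ≤ Z`,
`0 ≤ t ≤ T`, `t < T'`, `‖∇u(t)‖² = 𝒵_ν(E, Z, T)`, and `IsAxisymmetric (u s) ∧ HasNoSwirl (u s)` for
`s ∈ [0, t]`. (Implied by "every exact maximiser is axisymmetric swirl-free up to a rigid motion and
null sets" via Euclidean invariance of the admissible class and of `maxEnstrophy`; also reachable by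
symmetrising one maximiser.) [cite: LuDoering2008, §4 (maximising branch: axisymmetric colliding
rings); KangYunProtas2020, §5; AyalaProtas2017, §3 (Euler–Lagrange system); RamirezProtas2026 =
arXiv:2604.13338 (symmetry loss of extended maximisers: the risk)] [status: open] -/
theorem stub_symmetricMaximiserExists :
    ∀ ν : ℝ, 0 < ν → ∀ (E Z : ℝ≥0) (T : ℝ), 0 < E → 0 < Z → 0 < T →
      maxEnstrophy ν E Z T < ⊤ → IsMaxEnstrophyAttained ν E Z T →
      ∃ (T' : ℝ) (u : ℝ → ℝ³ → ℝ³) (t : ℝ), IsLerayHopfTrajectory ν T' u ∧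
        eEnergy (u 0) ≤ E ∧ eWeakGradL2Sq (u 0) ≤ Z ∧ 0 ≤ t ∧ t ≤ T ∧ t < T' ∧
        eWeakGradL2Sq (u t) = maxEnstrophy ν E Z T ∧
        ∀ s ∈ Set.Icc 0 t, IsAxisymmetric (u s) ∧ HasNoSwirl (u s) := by
  sorry

/-- **stub 2 — `stub_swirlFreeMaximiserLaw` (V2b, the swirl-free law at exact maximisers; size XL,
load-bearing).** For every `ν > 0` there is `C ≥ 1` such that at every finite level `(E, Z, T)`
every exact maximiser which is axisymmetric without swirl on `[0, t]` obeys
`‖∇u(t)‖² ≤ Φ_C(E, Z)/2 = C · Z · (1 + √(E Z)) / 2` (`enstrophyMajorant`, halved in `ℝ≥0∞`).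
Structure available: `ω = ω_θ e_θ`, transport–diffusion of `ω_θ / r`, Ladyzhenskaya's weighted
estimate and the Grönwall step of Lemarié-Rieusset 2016 Thm. 10.4 (tree: the PROVED fact
`axisymmetricNoSwirl_enstrophy_apriori`, and `axisymmetricNoSwirl_weightedEnstrophy_le`) — which as
printed depend on `‖∇ω₀‖₂`, not on `(E, Z)`; the `(E, Z)`-uniform law is asked only at exact
maximisers, where the KKT system of the finite-time problem is available. [cite: LemarieRieusset2016,
Thm. 10.4 pp. 285–289; Ladyzhenskaya1968; UkhovskiiYudovich1968; AyalaProtas2017, §3;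
KangYunProtas2020, §5 eq. (5.1) (growth `≈ 𝓔₀^{3/2}`)] [status: open] -/
theorem stub_swirlFreeMaximiserLaw :
    ∀ ν : ℝ, 0 < ν → ∃ C : ℝ≥0, 1 ≤ C ∧ ∀ (E Z : ℝ≥0) (T : ℝ), 0 < E → 0 < Z → 0 < T →
      maxEnstrophy ν E Z T < ⊤ →
      ∀ (T' : ℝ) (u : ℝ → ℝ³ → ℝ³) (t : ℝ), IsLerayHopfTrajectory ν T' u →
        eEnergy (u 0) ≤ E → eWeakGradL2Sq (u 0) ≤ Z → 0 ≤ t → t ≤ T → t < T' →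
        (∀ s ∈ Set.Icc 0 t, IsAxisymmetric (u s) ∧ HasNoSwirl (u s)) →
        eWeakGradL2Sq (u t) = maxEnstrophy ν E Z T →
        eWeakGradL2Sq (u t) ≤ (enstrophyMajorant C E Z : ℝ≥0∞) / 2 := by
  sorry

/-- **Composition, closed form (real proof, no `sorry`): the two stub STATEMENTS imply the crux,
stated through its definiens verbatim (the signature of item stmt-NavierStokesRegularity-18663), so
that `MaximiserRigidity_of` below is the only theorem of this file concluding the crux BY NAME.**
Take `C` from V2b; an exact maximiser `u` at level `(E, Z, T)` witnesses attainment, V2a yields a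
symmetric maximiser `v` at the same level, `‖∇u(t)‖² = 𝒵_ν(E, Z, T) = ‖∇v(s)‖²`, and V2b bounds the
latter. Axioms: propext, Classical.choice, Quot.sound. -/
theorem MaximiserRigidity_of_hyps
    (hV2a : ∀ ν : ℝ, 0 < ν → ∀ (E Z : ℝ≥0) (T : ℝ), 0 < E → 0 < Z → 0 < T →
      maxEnstrophy ν E Z T < ⊤ → IsMaxEnstrophyAttained ν E Z T →
      ∃ (T' : ℝ) (u : ℝ → ℝ³ → ℝ³) (t : ℝ), IsLerayHopfTrajectory ν T' u ∧
        eEnergy (u 0) ≤ E ∧ eWeakGradL2Sq (u 0) ≤ Z ∧ 0 ≤ t ∧ t ≤ T ∧ t < T' ∧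
        eWeakGradL2Sq (u t) = maxEnstrophy ν E Z T ∧
        ∀ s ∈ Set.Icc 0 t, IsAxisymmetric (u s) ∧ HasNoSwirl (u s))
    (hV2b : ∀ ν : ℝ, 0 < ν → ∃ C : ℝ≥0, 1 ≤ C ∧ ∀ (E Z : ℝ≥0) (T : ℝ), 0 < E → 0 < Z → 0 < T →
      maxEnstrophy ν E Z T < ⊤ →
      ∀ (T' : ℝ) (u : ℝ → ℝ³ → ℝ³) (t : ℝ), IsLerayHopfTrajectory ν T' u →
        eEnergy (u 0) ≤ E → eWeakGradL2Sq (u 0) ≤ Z → 0 ≤ t → t ≤ T → t < T' →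
        (∀ s ∈ Set.Icc 0 t, IsAxisymmetric (u s) ∧ HasNoSwirl (u s)) →
        eWeakGradL2Sq (u t) = maxEnstrophy ν E Z T →
        eWeakGradL2Sq (u t) ≤ (enstrophyMajorant C E Z : ℝ≥0∞) / 2) :
    ∀ ν : ℝ, 0 < ν → ∃ C : NNReal, 1 ≤ C ∧ ∀ (E Z : NNReal) (T : ℝ), 0 < E → 0 < Z → 0 < T →
      Literature.Analysis.FluidPDE.maxEnstrophy ν E Z T < ⊤ →
      ∀ (T' : ℝ) (u : ℝ → EuclideanSpace ℝ (Fin 3) → EuclideanSpace ℝ (Fin 3)) (t : ℝ),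
        Literature.Analysis.FluidPDE.IsLerayHopfTrajectory ν T' u →
        Literature.Analysis.FluidPDE.eEnergy (u 0) ≤ E →
        Literature.Analysis.FluidPDE.eWeakGradL2Sq (u 0) ≤ Z → 0 ≤ t → t ≤ T → t < T' →
        Literature.Analysis.FluidPDE.eWeakGradL2Sq (u t) =
          Literature.Analysis.FluidPDE.maxEnstrophy ν E Z T →
        Literature.Analysis.FluidPDE.eWeakGradL2Sq (u t) ≤
          (Literature.Analysis.FluidPDE.enstrophyMajorant C E Z : ENNReal) / 2 := by
  intro ν hν
  obtain ⟨C, hC1, hC⟩ := hV2b ν hν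
  refine ⟨C, hC1, ?_⟩
  intro E Z T hE hZ hT hfin T' u t htraj hEu hZu h0 htT htT' hmax
  obtain ⟨T₁, v, s, hv, hEv, hZv, hs0, hsT, hsT₁, hvmax, hsym⟩ :=
    hV2a ν hν E Z T hE hZ hT hfin ⟨T', u, t, htraj, hEu, hZu, h0, htT, htT', hmax⟩
  calc eWeakGradL2Sq (u t) = maxEnstrophy ν E Z T := hmax
    _ = eWeakGradL2Sq (v s) := hvmax.symm
    _ ≤ (enstrophyMajorant C E Z : ℝ≥0∞) / 2 :=
        hC E Z T hE hZ hT hfin T₁ v s hv hEv hZv hs0 hsT hsT₁ hsym hvmax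

/-- **Birth composition (the skeleton theorem, A12 shape): the crux BY NAME from the two
registered stubs, used by name; all glue is in the closed `MaximiserRigidity_of_hyps`.**
(Closed modulo the `sorry`s of `stub_symmetricMaximiserExists` and `stub_swirlFreeMaximiserLaw`
only.) -/
theorem MaximiserRigidity_of : MaximiserRigidity :=
  MaximiserRigidity_of_hyps stub_symmetricMaximiserExists stub_swirlFreeMaximiserLaw

end Summit.NavierStokesRegularity.NavierStokesRegularity.Cruxes.MaximiserRigidity.Birth

end
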